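import Summits.QuantumFields.YangMills.Theorems.SpecificationCompactnessAveragingReverseAC
import Summits.QuantumFields.YangMills.Theorems.BalabanUVNodesN11AveragingSkewPresentationAtRecord
import Literature.MathematicalPhysics.QuantumFieldTheory.Balaban1983to89.Node00.TkFirstStepRegionVanishing
import Summits.QuantumFields.YangMills.Theorems.BalabanUVNodesK0BgProvisoOverRangeLinear
import Literature.MathematicalPhysics.QuantumFieldTheory.Balaban1983to89.B10StarCount

/-!
# DAG node N11 ∕ key K1⁹ — REVERSE HAAR ABSOLUTE CONTINUITY OF 11a's RESTRICTED AVERAGING OF RECORD (the (R1) row of the located sentence's off-top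
# support inclusion is a THEOREM), and a.e. positivity of the restricted kernel transport of (2.21) on positive bounded integrands (count-neutral, LOCATED)

HEADER — WORK-UNIT METADATA.  Cell `pub-ymgap`, YM-PLAN Track A (HUMAN RULING D-0062), seat `pub-ymgap-dag-n11-d` (g37; N11 [B14], s2), route `BalabanUVNodes`, item K1⁹ =
stmt-QuantumFields-27364 (helper lane, `--kind proof --supports 27364 --as helper`, count-neutral).  [III] = [Balaban1988Convergent], [I] = [Balaban1987RG1].
CONSUMED BY NAME, nothing modified: the abstract reverse-push-forward engine of route `SpecificationCompactness` (width seat ym-line-sfw-p2-w2: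
`ReversePushforward.pi_le_smul_map_of_eq_on`, and the full-torus lattice combinatorics `AveragingPrivateLinks.{openHol_unit, link_injective, link_ne_centralBond}`,
`AveragingReverseAC.{pre∕post∕first∕rest_eq_of_agree, exists_transverse, exists_off_unit, haar_instances}`), pub-balaban's `BlockAveragingHaarAC` (`centralBond`,
`centralBond_injective`, `axialAvg_eq_pre_mul_mul_post`, `avgFun_of_not_small`, `loopHol_eq_openHol_mul`), `B10StarCount.blockOf_shift`, dag-n11-e's
`Node00.AveragingSkewPresentation.centralBond_mem_bondsIn_iff` and `…N11AveragingSkewPresentationAtRecord.toFine_mem_compl_Omega_iff` (the saturation of def-R's regions),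
def-T's 11a `Node00.TkOfRecord` (`kernelRT`, `avgRestrOfRecord`, `genDataOfRecord`), the disintegration API `T4AveragingDisintegration` (`margDensity`, `condLaw`,
`kernelTransport`), def-P11∕n07's diagonal phase witness `K0BgProvisoOverRange.exists_su_conj_norm_sub_one_ge`, Mathlib's `Measure.rnDeriv_pos'`.

WHY (index `N11-G36-FLAG15-CERT-5.md` § «what is left», dag-n11-d g36).  After FLAG №15 certificate #5 the located sentence for K1⁹ v10 reads: consequent ⟸ K0's three R-side
conjuncts + signs + `Cor3_250`@version + window + run rows + ONE R-level V-TRANSPORT statement per child `s` with `Ω_{k+1}(s) ≠ 𝕋` («a.e. on the `χ_{k+1}(s)`-support,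
`0 < ρ_{k+1}(s)(V) → 0 < I^G_P(s)(V)`»), and that statement reduces per generation to (R1) REVERSE Haar-a.c. of 11a's restricted block averaging `avgRestrOfRecord`
(`Π_{sV′} Haar ≪ (Π_{sV} Haar).map avgRestr` — the tree had only the FORWARD direction, n11-e's `map_pi_avgRestrOfRecord_absolutelyContinuous` = `hac_out`), (R2) def-T's
operand rows, (R3) Fubini across generations.  THIS FILE MAKES (R1) A THEOREM (every generation `j` in the standing range, every history, every branch, every `N ≥ 2`) and
supplies the generic positivity half of the k-th generation: under reverse a.c. the restricted kernel transport of a positive bounded measurable integrand is positive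
product-Haar-a.e. in the image-bond variables.  The sequel `…N11K1SupportsOffTopFirstStep` consumes both at `k = 0`.

WHAT THIS FILE PROVES (theorems only; 0 `def`, 0 `sorry`, standard axioms).
§1 (generic measure theory, [folklore]) `margDensity_pos_ae_of_reverseAC` (`μ ≪ avg_*ν ⇒ d(avg_*ν)∕dμ > 0` `μ`-a.e.: `rnDeriv_pos'` + `rnDeriv_lt_top`) · `integral_condLaw_pos` (the
   conditional law is a probability measure: a positive bounded measurable integrand has positive integral at EVERY coarse point) · `kernelTransport_pos_of_margDensity_pos` ·
   `kernelTransport_pos_ae_of_reverseAC` · 11a-keyed `kernelRT_pos_of_margDensity_pos` ∕ `kernelRT_pos_ae_of_reverseAC`.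
§2 (lattice geometry, [folklore]) `blockOf_emb_shift` ∕ `blockOf_emb_shift_shift` (one or two unit steps from a block centre stay in the block, `L ≥ 3`) · ★ `link_mem_bondsIn` (the
   PRIVATE LINK `ℓ(c) = ⟨emb c₋ + e_ν, μ⟩` of a coarse bond `c` of a saturated region `Y` is a fine bond of `Y`).
§3 (any gauge group with a regular two-sided-invariant Haar datum, any small-loop average `ℰ` with measurable inner operation and a guard that is not almost sure, `d ≥ 2`,
   standing range) ★★ `pi_le_smul_map_avgFun_restrict` — for `Y` saturated at level `j+1`, `bondsIn j Y ⊆ sV`, `sV′ ⊆ bondsIn (j+1) Y`: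
   `Π_{sV′} Haar ≤ (Haar{δ ≤ |g−1|}^{|sV′|})⁻¹ • (Π_{sV} Haar).map (y ↦ (Ū(ext₁ y)(c))_{c∈sV′})` (`ext₁` = extension by `1` off `sV`, which is 11a's `avgRestrOfRecord` shape);
   ★★ `pi_absolutelyContinuous_map_avgFun_restrict`.  MECHANISM: the width seat's two PRIVATE FAMILIES — the central crossing bonds `β(c)` and the private links `ℓ(c)`,
   `c ∈ sV′` — live INSIDE `sV` (§2 + `centralBond_mem_bondsIn_iff`), so the abstract engine applies verbatim to the restricted map with `ι := sV`, `κ := sV′`: after resampling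
   both families the axial averages are `pre·g·post` and the chosen off-central open holonomies `p·u·s` with coefficients NOT reading the resampled coordinates (the full-torus
   agreement lemmas at the extended configurations), and off the (0.4) guard `Ū(c) = U(c)`.
§4 (of record, `G = SU(N)`, `ℰ` = exp[mean log]) ★★ `pi_absolutelyContinuous_map_avgRestrOfRecord` (displayed: the guard is not a.s., `hR0`) · ★★
   `pi_absolutelyContinuous_map_avgRestrOfRecord_genData` (at 11a's `genDataOfRecord … s S j`: V-bonds `bondsIn j (Ω_{j+1}(s))ᶜ`, image bonds `bondsIn (j+1) (Ω_{j+1}(s))ᶜ`; saturation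
   by n11-e's theorem).
§5 ★ `haar_setOf_delta_le_dist1_ne_zero` (`N ≥ 2`: `δ = min(1∕3, π∕N) < 2 = |D − 1|` at the diagonal phase witness; open sets have positive Haar measure) · ★★★
   `pi_absolutelyContinuous_map_avgRestrOfRecord_of_two_le` · ★★★ `pi_absolutelyContinuous_map_avgRestrOfRecord_genData_of_two_le` — (R1) HYPOTHESIS-FREE for every `N ≥ 2`
   (for the trivial group `SU(1)` the guard never fails and the engine does not apply; not needed).

LOCATOR CORRECTION OF RECORD (ref-K READ-535 NIT-1 on ✓p736567, inherited from ✓p735295 l.52∕57): the quadratic form `⟨A, Δ^{(j)}A⟩` of the Gaussian A-weight cited there as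
«[I] (1.15)–(1.16) p.262» is [I] (1.5) p.261 ∕ (2.11) p.267; [I] (1.15)–(1.16) p.262 is the complex-domain pair `(U_n(M′(U)), J_n(M′(U)))` with its bounds.  Shape-only; no
mathematics affected; recorded here instead of a doc-only re-issue of K∕N.

HONEST FRAMING.  [folklore] measure theory (push-forward, product measure, Radon–Nikodym, disintegration) and lattice combinatorics about the published formula (0.4) [I] and the
(2.21) [III] restricted V-integration, over landed definitions; the cites are LOCATORS of the averaging ∕ the 𝐓-operation, not claims; nothing of Bałaban's estimates ([I] §2,
[III] §3) asserted or refuted; no K1⁹ witness; N11 NOT discharged; K1⁹ NOT closed; counts unmoved (typed 28∕28 · discharged 8∕27 = 8∕28 incl. NODE O).  One finite four-torus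
programme at fixed `ε = L^{−K}`; R4 = the conditional finite-𝕋⁴ rung `BalabanLadder.UV` only; NOT ℝ⁴, NOT OS, NOT a mass gap, NOT Clay.  No `sorry`, `axiom`, `def`,
`instance`, `notation`.  Sources (locators): [I] (0.1) p.251, (0.3)–(0.4) pp.252–253; [III] (2.1) p.254, (2.21) p.258; [Balaban1985Averaging] (10) p.19.
-/

noncomputable section

open MeasureTheory Function
open scoped ENNReal NNReal

namespace Summit.QuantumFields.YangMills.Theorems.BalabanUVNodesN11RestrictedAveragingReverseAC

open Literature.MathematicalPhysics.QuantumFieldTheory.Balaban1983to89 T4AveragingDisintegration T4Continuum AveragingRT BlockAveraging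
  BlockAveragingHaarAC
open B10Eq42TorusConstraint (bondsIn mem_bondsIn_iff)
open B10Eq38TorusDomains (toFine)
open Summit.QuantumFields.YangMills.Theorems.AveragingPrivateLinks
open Summit.QuantumFields.YangMills.Theorems.AveragingReverseAC (pre_eq_of_agree post_eq_of_agree first_eq_of_agree rest_eq_of_agree
  exists_transverse exists_off_unit haar_instances)

/-! ## §1  Generic: under REVERSE absolute continuity the marginal density of a kernel transport is a.e. positive, and the transport of a positive bounded
measurable integrand is a.e. positive -/

section Generic

variable {α β : Type*} [MeasurableSpace α] [MeasurableSpace β]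

/-- **REVERSE A.C. ⇒ THE MARGINAL DENSITY IS `μ`-a.e. POSITIVE**: if `μ ≪ avg_* ν` then `d(avg_* ν)∕dμ > 0` `μ`-a.e. (Mathlib's `Measure.rnDeriv_pos'` and
`rnDeriv_lt_top`; `margDensity` is the `ℝ≥0`-valued version of that Radon–Nikodym derivative). [folklore] -/
theorem margDensity_pos_ae_of_reverseAC (ν : Measure β) [IsFiniteMeasure ν] (μ : Measure α) [SigmaFinite μ] {avg : β → α}
    (havg : Measurable avg) (hrev : μ ≪ ν.map avg) : ∀ᵐ y ∂μ, 0 < (margDensity ν μ avg y : ℝ) := by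
  have h1 := Measure.rnDeriv_pos' (ν := ν.map avg) (μ := μ) hrev
  have h2 := Measure.rnDeriv_lt_top (ν.map avg) μ
  filter_upwards [h1, h2] with y hy1 hy2
  show 0 < (((jointLaw ν avg).fst.rnDeriv μ y).toNNReal : ℝ)
  rw [jointLaw_fst ν havg]
  exact ENNReal.toReal_pos hy1.ne' hy2.ne

variable [StandardBorelSpace β] [Nonempty β]

/-- **THE CONDITIONAL LAW INTEGRATES A POSITIVE BOUNDED MEASURABLE FUNCTION TO A POSITIVE NUMBER** at EVERY coarse point (it is a probability measure).
[folklore] -/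
theorem integral_condLaw_pos (ν : Measure β) [IsFiniteMeasure ν] (avg : β → α) {f : β → ℝ} (hfm : Measurable f) (hpos : ∀ U, 0 < f U)
    {B : ℝ} (hB : ∀ U, f U ≤ B) (y : α) : 0 < ∫ U, f U ∂(condLaw ν avg y) := by
  have hint : Integrable f (condLaw ν avg y) := by
    refine (integrable_const B).mono' hfm.aestronglyMeasurable (Filter.Eventually.of_forall fun U => ?_)
    rw [Real.norm_eq_abs, abs_of_pos (hpos U)]
    exact hB U
  rw [integral_pos_iff_support_of_nonneg (fun U => (hpos U).le) hint]
  have hsupp : Function.support f = Set.univ := Set.eq_univ_of_forall fun U => (hpos U).ne'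
  rw [hsupp, measure_univ]
  exact one_pos

/-- **THE KERNEL TRANSPORT OF A POSITIVE BOUNDED MEASURABLE INTEGRAND IS POSITIVE WHEREVER THE MARGINAL DENSITY IS.** [folklore] -/
theorem kernelTransport_pos_of_margDensity_pos (ν : Measure β) [IsFiniteMeasure ν] (μ : Measure α) (avg : β → α) {f : β → ℝ}
    (hfm : Measurable f) (hpos : ∀ U, 0 < f U) {B : ℝ} (hB : ∀ U, f U ≤ B) {y : α} (hy : 0 < (margDensity ν μ avg y : ℝ)) :
    0 < kernelTransport ν μ avg f y :=
  mul_pos hy (integral_condLaw_pos ν avg hfm hpos hB y)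

/-- **… HENCE `μ`-a.e. POSITIVE UNDER REVERSE A.C.** [folklore] -/
theorem kernelTransport_pos_ae_of_reverseAC (ν : Measure β) [IsFiniteMeasure ν] (μ : Measure α) [SigmaFinite μ] {avg : β → α}
    (havg : Measurable avg) (hrev : μ ≪ ν.map avg) {f : β → ℝ} (hfm : Measurable f) (hpos : ∀ U, 0 < f U) {B : ℝ} (hB : ∀ U, f U ≤ B) :
    ∀ᵐ y ∂μ, 0 < kernelTransport ν μ avg f y := by
  filter_upwards [margDensity_pos_ae_of_reverseAC ν μ havg hrev] with y hy
  exact kernelTransport_pos_of_margDensity_pos ν μ avg hfm hpos hB hy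

end Generic

section GenericRT

universe u

variable {G : Type u} [GaugeGroup G] [MeasurableSpace G] [HaarData G] [StandardBorelSpace G]

/-- **11a's RESTRICTED KERNEL TRANSPORT `kernelRT avg` OF A POSITIVE BOUNDED MEASURABLE INTEGRAND IS POSITIVE AT EVERY COARSE CONFIGURATION WHERE THE MARGINAL
DENSITY OF `avg_*(Π Haar)` IS** — in particular at product-Haar-a.e. coarse configuration once `Π Haar ≪ avg_*(Π Haar)` (reverse a.c.).
[cite: Balaban1988Convergent, (2.21) p.258 (bookkeeping)] -/
theorem kernelRT_pos_of_margDensity_pos {ι ι' : Type*} [Fintype ι] [Fintype ι'] (avg : (ι → G) → (ι' → G)) {f : (ι → G) → ℝ}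
    (hfm : Measurable f) (hpos : ∀ y, 0 < f y) {B : ℝ} (hB : ∀ y, f y ≤ B) {y' : ι' → G}
    (hy : 0 < (margDensity (Measure.pi fun _ : ι => (HaarData.haar : Measure G)) (Measure.pi fun _ : ι' => (HaarData.haar : Measure G)) avg y' : ℝ)) :
    0 < Node00.Tk.kernelRT avg f y' :=
  kernelTransport_pos_of_margDensity_pos _ _ avg hfm hpos hB hy

/-- … and product-Haar-a.e. under reverse a.c. of the restricted averaging. [cite: Balaban1988Convergent, (2.21) p.258 (bookkeeping)] -/
theorem kernelRT_pos_ae_of_reverseAC {ι ι' : Type*} [Fintype ι] [Fintype ι'] {avg : (ι → G) → (ι' → G)} (havg : Measurable avg)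
    (hrev : (Measure.pi fun _ : ι' => (HaarData.haar : Measure G)) ≪ (Measure.pi fun _ : ι => (HaarData.haar : Measure G)).map avg)
    {f : (ι → G) → ℝ} (hfm : Measurable f) (hpos : ∀ y, 0 < f y) {B : ℝ} (hB : ∀ y, f y ≤ B) :
    ∀ᵐ y' ∂(Measure.pi fun _ : ι' => (HaarData.haar : Measure G)), 0 < Node00.Tk.kernelRT avg f y' :=
  kernelTransport_pos_ae_of_reverseAC _ _ havg hrev hfm hpos hB

end GenericRT

/-! ## §2  Lattice geometry: the private link `ℓ(c) = ⟨emb c₋ + e_ν, μ⟩` of a coarse bond of a saturated region is a fine bond of that region -/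

section Links

variable {P : Params} {j : ℕ}

/-- One unit step from a block centre stays in the block (`L ≥ 3`). [cite: Balaban1987RG1, (0.1) p.252 (bookkeeping)] -/
theorem blockOf_emb_shift (hj : j + 1 ≤ P.m + P.K) (y : Site P (j + 1)) (ν : Fin P.d) : blockOf ((emb y).shift ν) = y := by
  rw [B10StarCount.blockOf_shift hj]
  have hL1 : 1 < P.L := P.hL.2
  have hmod : ((emb y) ν).val % P.L = (P.L - 1) / 2 := by
    rw [Site.val_emb hj, Nat.mul_add_mod', Nat.mod_eq_of_lt (by omega)]
  rw [if_neg (by rw [hmod]; omega), Site.blockOf_emb hj]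

/-- Two unit steps in DIFFERENT directions from a block centre stay in the block (`L ≥ 3`). [cite: Balaban1987RG1, (0.1) p.252 (bookkeeping)] -/
theorem blockOf_emb_shift_shift (hj : j + 1 ≤ P.m + P.K) (y : Site P (j + 1)) {ν μ : Fin P.d} (hνμ : ν ≠ μ) :
    blockOf (((emb y).shift ν).shift μ) = y := by
  rw [B10StarCount.blockOf_shift hj]
  have hL1 : 1 < P.L := P.hL.2
  have hmod : (((emb y).shift ν) μ).val % P.L = (P.L - 1) / 2 := by
    rw [B10StarCount.shift_apply_ne _ hνμ.symm, Site.val_emb hj, Nat.mul_add_mod', Nat.mod_eq_of_lt (by omega)]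
  rw [if_neg (by rw [hmod]; omega), blockOf_emb_shift hj]

/-- **THE PRIVATE LINK OF A COARSE BOND OF A SATURATED REGION IS A FINE BOND OF THE REGION**: for `Y` saturated at level `j+1` and `c ∈ bondsIn (j+1) Y`,
`⟨emb c₋ + e_ν, μ⟩ ∈ bondsIn j Y` (`ν ≠ μ = dir c`; both endpoints lie in the block `B(c₋) ⊆ Y`). [cite: Balaban1987RG1, (0.4) p.253 (bookkeeping)] -/
theorem link_mem_bondsIn (hj : j + 1 ≤ P.m + P.K) {Y : Set (Site P 0)} (hY : ∀ s : Site P j, toFine j s ∈ Y ↔ toFine (j + 1) (blockOf s) ∈ Y)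
    (τ : Fin P.d → Fin P.d) {c : PBond P (j + 1)} (hτ : τ c.dir ≠ c.dir) (hc : c ∈ bondsIn (j + 1) Y) :
    (⟨(emb c.src).shift (τ c.dir), c.dir⟩ : PBond P j) ∈ bondsIn j Y := by
  rw [mem_bondsIn_iff, hY, hY]
  refine ⟨?_, ?_⟩
  · show toFine (j + 1) (blockOf ((emb c.src).shift (τ c.dir))) ∈ Y
    rw [blockOf_emb_shift hj]
    exact hc.1
  · show toFine (j + 1) (blockOf (((emb c.src).shift (τ c.dir)).shift c.dir)) ∈ Y
    rw [blockOf_emb_shift_shift hj _ hτ]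
    exact hc.1

end Links

/-! ## §3  REVERSE absolute continuity of the RESTRICTED (0.4) block averaging over a saturated region (any gauge group, any small-loop average) -/

section Restricted

variable {P : Params} {j : ℕ} {G : Type*} [GaugeGroup G] [MeasurableSpace G] [HaarData G] [RegularGaugeGroup G]

omit [MeasurableSpace G] [HaarData G] [RegularGaugeGroup G] in
/-- The extension by `1` of a configuration of the `sV`-bond variables, read on a bond of `sV`. [folklore] -/
theorem updateFinset_one_apply_of_mem [DecidableEq (PBond P j)] {sV : Finset (PBond P j)} (y : ↥sV → G) {b : PBond P j} (hb : b ∈ sV) :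
    updateFinset (fun _ => (1 : G)) sV y b = y ⟨b, hb⟩ := by
  simp only [updateFinset_def, dif_pos hb]

omit [MeasurableSpace G] [HaarData G] [RegularGaugeGroup G] in
/-- … and off `sV`. [folklore] -/
theorem updateFinset_one_apply_of_not_mem [DecidableEq (PBond P j)] {sV : Finset (PBond P j)} (y : ↥sV → G) {b : PBond P j} (hb : b ∉ sV) :
    updateFinset (fun _ => (1 : G)) sV y b = 1 := by
  simp only [updateFinset_def, dif_neg hb]

/-- **REVERSE DOMINATION FOR THE RESTRICTED BLOCK AVERAGING** (standing range, `d ≥ 2`, any small-loop average `ℰ` with measurable inner operation whose guard is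
not almost sure): for a fine region `Y` saturated at level `j+1`, bond finsets `sV ⊇ bondsIn j Y` and `sV' ⊆ bondsIn (j+1) Y`, the restricted averaging
`y ↦ (c ↦ Ū(ext₁ y)(c))_{c ∈ sV'}` (`ext₁` = extension by `1` off `sV`) satisfies `Π_{sV'} Haar ≤ (Haar{δ ≤ |g−1|}^{|sV'|})⁻¹ • (Π_{sV} Haar).map (…)`.  MECHANISM: the
abstract engine `ReversePushforward.pi_le_smul_map_of_eq_on` with BOTH private families of the full-torus argument (`AveragingReverseAC.fieldMeasure_le_smul_map_avgFun`) —
the central crossing bonds `β(c)` and the private links `ℓ(c)` — living INSIDE `sV` (§2 and `centralBond_mem_bondsIn_iff`); the coefficient transports `pre`, `post`, the first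
transverse step and the rest of the chosen loop do not read the resampled coordinates (the full-torus agreement lemmas applied to the extended configurations).
[cite: Balaban1987RG1, (0.4) p.253; Balaban1988Convergent, (2.21) p.258 (bookkeeping)] -/
theorem pi_le_smul_map_avgFun_restrict [DecidableEq (PBond P j)] (hj : j + 1 ≤ P.m + P.K) (hd : 2 ≤ P.d) (ℰ : LoopAverage G)
    (hE : ∀ n, Measurable (fun W : Fin (n + 1) → G => ℰ.E W)) (hR0 : (HaarData.haar : Measure G) {g | ℰ.δ ≤ dist1 g} ≠ 0)
    {Y : Set (Site P 0)} (hY : ∀ s : Site P j, toFine j s ∈ Y ↔ toFine (j + 1) (blockOf s) ∈ Y)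
    {sV : Finset (PBond P j)} (hsV : ∀ b : PBond P j, b ∈ bondsIn j Y → b ∈ sV)
    {sV' : Finset (PBond P (j + 1))} (hsV' : ∀ c : PBond P (j + 1), c ∈ sV' → c ∈ bondsIn (j + 1) Y) :
    (Measure.pi fun _ : ↥sV' => (HaarData.haar : Measure G)) ≤
      ((HaarData.haar : Measure G) {g | ℰ.δ ≤ dist1 g} ^ Fintype.card ↥sV')⁻¹ •
        (Measure.pi fun _ : ↥sV => (HaarData.haar : Measure G)).map
          (fun y (c : ↥sV') => avgFun ℰ (updateFinset (fun _ => (1 : G)) sV y) c) := by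
  classical
  obtain ⟨hprob, hleft, hright⟩ := haar_instances (G := G)
  obtain ⟨τ, hτ⟩ := exists_transverse (P := P) hd
  choose r hr using fun μ : Fin P.d => exists_off_unit (P := P) (τ μ)
  -- the two private families live inside `sV`
  have hβmem : ∀ c : ↥sV', centralBond (c : PBond P (j + 1)) ∈ sV := fun c =>
    hsV _ ((Node00.centralBond_mem_bondsIn_iff hj hY _).2 (hsV' _ c.2))
  have hℓmem : ∀ c : ↥sV', (⟨(emb (c : PBond P (j + 1)).src).shift (τ (c : PBond P (j + 1)).dir), (c : PBond P (j + 1)).dir⟩ : PBond P j) ∈ sV :=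
    fun c => hsV _ (link_mem_bondsIn hj hY τ (hτ _) (hsV' _ c.2))
  let β' : ↥sV' → ↥sV := fun c => ⟨centralBond (c : PBond P (j + 1)), hβmem c⟩
  let ℓ' : ↥sV' → ↥sV := fun c => ⟨⟨(emb (c : PBond P (j + 1)).src).shift (τ (c : PBond P (j + 1)).dir), (c : PBond P (j + 1)).dir⟩, hℓmem c⟩
  have hβ' : Injective β' := fun c c' h =>
    Subtype.ext (centralBond_injective hj (congrArg Subtype.val h : (β' c : PBond P j) = β' c'))
  have hℓ' : Injective ℓ' := fun c c' h =>
    Subtype.ext (link_injective hj τ (congrArg Subtype.val h : (ℓ' c : PBond P j) = ℓ' c'))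
  have hℓβ : ∀ c c' : ↥sV', ℓ' c ≠ β' c' := fun c c' h =>
    link_ne_centralBond hj τ hτ (c : PBond P (j + 1)) (c' : PBond P (j + 1)) (congrArg Subtype.val h)
  -- the extension by `1` off `sV` is measurable
  have hext : Measurable (updateFinset (fun _ : PBond P j => (1 : G)) sV) := measurable_updateFinset
  -- the resampled configuration read through the extension
  have hprops : ∀ (y : ↥sV → G) (g u : ↥sV' → G),
      (∀ b : PBond P j, (∀ c' : PBond P (j + 1), b ≠ centralBond c') →
        (∀ c' : PBond P (j + 1), b ≠ ⟨(emb c'.src).shift (τ c'.dir), c'.dir⟩) → updateFinset (fun _ => (1 : G)) sV (extend ℓ' u (extend β' g y)) b = updateFinset (fun _ => (1 : G)) sV y b) ∧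
      (∀ c : ↥sV', updateFinset (fun _ => (1 : G)) sV (extend ℓ' u (extend β' g y)) (centralBond (c : PBond P (j + 1))) = g c) ∧
      (∀ c : ↥sV', updateFinset (fun _ => (1 : G)) sV (extend ℓ' u (extend β' g y)) ⟨(emb (c : PBond P (j + 1)).src).shift (τ (c : PBond P (j + 1)).dir), (c : PBond P (j + 1)).dir⟩ = u c) := by
    intro y g u
    refine ⟨fun b hb1 hb2 => ?_, fun c => ?_, fun c => ?_⟩
    · by_cases hb : b ∈ sV
      · rw [updateFinset_one_apply_of_mem _ hb, updateFinset_one_apply_of_mem _ hb,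
          extend_apply' _ _ _ (fun ⟨c', hc'⟩ => hb2 c' (congrArg Subtype.val hc').symm),
          extend_apply' _ _ _ (fun ⟨c', hc'⟩ => hb1 c' (congrArg Subtype.val hc').symm)]
      · rw [updateFinset_one_apply_of_not_mem _ hb, updateFinset_one_apply_of_not_mem _ hb]
    · rw [updateFinset_one_apply_of_mem _ (hβmem c), show (⟨centralBond (c : PBond P (j + 1)), hβmem c⟩ : ↥sV) = β' c from rfl,
        extend_apply' _ _ _ (fun ⟨c', hc'⟩ => hℓβ c' c hc'), hβ'.extend_apply]
    · rw [updateFinset_one_apply_of_mem _ (hℓmem c),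
        show (⟨⟨(emb (c : PBond P (j + 1)).src).shift (τ (c : PBond P (j + 1)).dir), (c : PBond P (j + 1)).dir⟩, hℓmem c⟩ : ↥sV) = ℓ' c from rfl,
        hℓ'.extend_apply]
  refine ReversePushforward.pi_le_smul_map_of_eq_on (HaarData.haar : Measure G) hβ' hℓ'
    (fun y c => axialAvg (updateFinset (fun _ => (1 : G)) sV y) c)
    (fun y c => openHol (updateFinset (fun _ => (1 : G)) sV y) c (r (c : PBond P (j + 1)).dir, 1, 1))
    (measurable_pi_lambda _ fun c => (measurable_pi_apply (c : PBond P (j + 1))).comp (measurable_axialAvg.comp hext))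
    (measurable_pi_lambda _ fun c => (measurable_holAt _).comp hext)
    (fun y c => pre (updateFinset (fun _ => (1 : G)) sV y) c) (fun y c => post (updateFinset (fun _ => (1 : G)) sV y) c)
    (fun y c => updateFinset (fun _ => (1 : G)) sV y ⟨emb (c : PBond P (j + 1)).src, τ (c : PBond P (j + 1)).dir⟩)
    (fun y c => holAt (updateFinset (fun _ => (1 : G)) sV y) (walk (((emb (c : PBond P (j + 1)).src).shift (τ (c : PBond P (j + 1)).dir)).shift (c : PBond P (j + 1)).dir)
      (List.replicate (P.L - 1) ((c : PBond P (j + 1)).dir, true) ++ [(τ (c : PBond P (j + 1)).dir, false)])))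
    (fun y g u c => ?_) (fun y g u c => ?_) (fun y (c : ↥sV') => avgFun ℰ (updateFinset (fun _ => (1 : G)) sV y) c)
    (measurable_pi_lambda _ fun c => (measurable_pi_apply (c : PBond P (j + 1))).comp ((measurable_avgFun ℰ hE).comp hext))
    (measurableSet_le measurable_const RegularGaugeGroup.measurable_dist1) hR0 (fun y hy => ?_)
  · -- `A = pre · g · post` after resampling
    obtain ⟨hXU, hβ, -⟩ := hprops y g u
    rw [axialAvg_eq_pre_mul_mul_post, pre_eq_of_agree hj τ hτ hXU, post_eq_of_agree hj τ hτ hXU, hβ]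
  · -- `V = p · u · s` after resampling
    obtain ⟨hXU, -, hℓ⟩ := hprops y g u
    rw [openHol_unit _ (c : PBond P (j + 1)) (r (c : PBond P (j + 1)).dir) (τ (c : PBond P (j + 1)).dir) (hr (c : PBond P (j + 1)).dir),
      first_eq_of_agree hj τ hXU, hℓ, rest_eq_of_agree hj τ hτ hXU, mul_assoc]
  · -- off the guard the block averaging is the axial one
    funext c
    refine avgFun_of_not_small ℰ (updateFinset (fun _ => (1 : G)) sV y) (c : PBond P (j + 1)) fun hS => ?_
    have h := hS (r (c : PBond P (j + 1)).dir, 1, 1)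
    rw [loopHol_eq_openHol_mul] at h
    exact not_lt.mpr (hy c) h

/-- **REVERSE ABSOLUTE CONTINUITY OF THE RESTRICTED BLOCK AVERAGING**: `Π_{sV'} Haar ≪ (Π_{sV} Haar).map (restricted Ū)` in the setting of
`pi_le_smul_map_avgFun_restrict`. [cite: Balaban1987RG1, (0.4) p.253; Balaban1988Convergent, (2.21) p.258 (bookkeeping)] -/
theorem pi_absolutelyContinuous_map_avgFun_restrict [DecidableEq (PBond P j)] (hj : j + 1 ≤ P.m + P.K) (hd : 2 ≤ P.d) (ℰ : LoopAverage G)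
    (hE : ∀ n, Measurable (fun W : Fin (n + 1) → G => ℰ.E W)) (hR0 : (HaarData.haar : Measure G) {g | ℰ.δ ≤ dist1 g} ≠ 0)
    {Y : Set (Site P 0)} (hY : ∀ s : Site P j, toFine j s ∈ Y ↔ toFine (j + 1) (blockOf s) ∈ Y)
    {sV : Finset (PBond P j)} (hsV : ∀ b : PBond P j, b ∈ bondsIn j Y → b ∈ sV)
    {sV' : Finset (PBond P (j + 1))} (hsV' : ∀ c : PBond P (j + 1), c ∈ sV' → c ∈ bondsIn (j + 1) Y) :
    (Measure.pi fun _ : ↥sV' => (HaarData.haar : Measure G)) ≪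
      (Measure.pi fun _ : ↥sV => (HaarData.haar : Measure G)).map (fun y (c : ↥sV') => avgFun ℰ (updateFinset (fun _ => (1 : G)) sV y) c) :=
  Measure.absolutelyContinuous_of_le_smul (pi_le_smul_map_avgFun_restrict hj hd ℰ hE hR0 hY hsV hsV')

end Restricted

/-! ## §4  OF RECORD (`G = SU(N)`, the averaging of record): reverse a.c. of 11a's `avgRestrOfRecord`, at any saturated region and at the generation data of record -/

section OfRecord

open Node00 Node00.Tk ExpMeanLog

variable (F : T4Family) (N : ℕ) [NeZero N]

/-- **★★ REVERSE HAAR-A.C. OF 11a's RESTRICTED AVERAGING OF RECORD** over a saturated region (`bondsIn j Y ⊆ sV`, `sV' ⊆ bondsIn (j+1) Y`, standing range), GIVEN that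
the (0.4) guard of the inner operation of record is not almost sure on `SU(N)` (`hR0`; true for `N ≥ 2`, vacuous-false for the trivial group `SU(1)`):
`Π_{sV'} Haar ≪ (Π_{sV} Haar).map (avgRestrOfRecord F N K j sV sV')` — the REVERSE of n11-e's `map_pi_avgRestrOfRecord_absolutelyContinuous` (`hac_out`).
[cite: Balaban1988Convergent, (2.21) p.258; Balaban1987RG1, (0.4) p.253 (bookkeeping)] -/
theorem pi_absolutelyContinuous_map_avgRestrOfRecord (K j : ℕ) [DecidableEq (PBond (F.P K) j)] (hj : j + 1 ≤ (F.P K).m + (F.P K).K)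
    (hR0 : (HaarData.haar : Measure (Node00.SU N)) {g | (expMeanLogSU : LoopAverage (Node00.SU N)).δ ≤ dist1 g} ≠ 0)
    {Y : Set (Site (F.P K) 0)} (hY : ∀ s : Site (F.P K) j, toFine j s ∈ Y ↔ toFine (j + 1) (blockOf s) ∈ Y)
    {sV : Finset (PBond (F.P K) j)} (hsV : ∀ b : PBond (F.P K) j, b ∈ bondsIn j Y → b ∈ sV)
    {sV' : Finset (PBond (F.P K) (j + 1))} (hsV' : ∀ c : PBond (F.P K) (j + 1), c ∈ sV' → c ∈ bondsIn (j + 1) Y) :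
    (Measure.pi fun _ : ↥sV' => (HaarData.haar : Measure (Node00.SU N))) ≪
      (Measure.pi fun _ : ↥sV => (HaarData.haar : Measure (Node00.SU N))).map (avgRestrOfRecord F N K j sV sV') := by
  have h := pi_absolutelyContinuous_map_avgFun_restrict (P := F.P K) (G := Node00.SU N) hj (by rw [T4Family.P_d]; norm_num)
    expMeanLogSU measurable_expMeanLogSU_E hR0 hY hsV hsV'
  have e : (fun (y : ↥sV → Node00.SU N) (c : ↥sV') => avgFun expMeanLogSU (updateFinset (fun _ => (1 : Node00.SU N)) sV y) c) = avgRestrOfRecord F N K j sV sV' := by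
    funext y c
    rw [avgRestrOfRecord, avOfRecord_avg]
  rw [e] at h
  exact h

open Classical in
/-- **★★ REVERSE HAAR-A.C. AT THE GENERATION DATA OF RECORD** (11a's `genDataOfRecord … s S j`: V-bonds `bondsIn j (Ω_{j+1}(s))ᶜ`, image bonds `bondsIn (j+1) (Ω_{j+1}(s))ᶜ`;
the saturation of `(Ω_{j+1}(s))ᶜ` is n11-e's theorem `toFine_mem_compl_Omega_iff`): product Haar on the image-bond variables is absolutely continuous with respect to the
push-forward of product Haar on the V-bond variables under the restricted averaging of record — so the restricted kernel transport `kernelRTOfRecord` of (2.21) has an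
a.e. POSITIVE marginal density (§1). [cite: Balaban1988Convergent, (2.21) p.258 (bookkeeping)] -/
theorem pi_absolutelyContinuous_map_avgRestrOfRecord_genData {V : Type} (ν : Stage7Numerics) (M : ℕ) (g : ℕ → ℝ) (K : ℕ) (W : TkWeights F N V K)
    {k : ℕ} (s : SeqOfRecord F ν M g K k) (S : ℕ → Set (Site (F.P K) 0)) (j : ℕ) {hdec : DecidableEq (PBond (F.P K) j)}
    (hj : j + 1 ≤ (F.P K).m + (F.P K).K) (hR0 : (HaarData.haar : Measure (Node00.SU N)) {g | (expMeanLogSU : LoopAverage (Node00.SU N)).δ ≤ dist1 g} ≠ 0) :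
    (Measure.pi fun _ : ↥(genDataOfRecord F N V ν M g K W s S j).sV' => (HaarData.haar : Measure (Node00.SU N))) ≪
      (Measure.pi fun _ : ↥(genDataOfRecord F N V ν M g K W s S j).sV => (HaarData.haar : Measure (Node00.SU N))).map
        (avgRestrOfRecord F N K j (genDataOfRecord F N V ν M g K W s S j).sV (genDataOfRecord F N V ν M g K W s S j).sV') :=
  pi_absolutelyContinuous_map_avgRestrOfRecord F N K j hj hR0 (BalabanUVNodesN11AveragingSkewPresentationAtRecord.toFine_mem_compl_Omega_iff s hj)
    (fun _ hb => (Set.Finite.mem_toFinset _).2 hb) (fun _ hc => (Set.Finite.mem_toFinset _).1 hc)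

end OfRecord

/-! ## §5  The (0.4) guard of the inner operation of record is NOT almost sure on `SU(N)`, `N ≥ 2`: hypothesis-free reverse a.c. of record -/

section Guard

open Node00 Node00.Tk ExpMeanLog

variable (F : T4Family) (N : ℕ) [NeZero N]

/-- **THE (0.4) GUARD IS NOT ALMOST SURE ON `SU(N)`, `N ≥ 2`**: `Haar{g | δ ≤ |g − 1|} ≠ 0` for the inner operation of record exp[mean log]
(`δ = min(1∕3, π∕N) ≤ 1∕3 < 2 = |D − 1|` at n07∕def-P11's diagonal phase witness `exists_su_conj_norm_sub_one_ge`; open sets have positive Haar measure —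
the `SU(2)` case is `UnitDensityPosAE.haar_setOf_delta_le_dist1_ne_zero`). [folklore] -/
theorem haar_setOf_delta_le_dist1_ne_zero (hN : 2 ≤ N) :
    (HaarData.haar : Measure (Node00.SU N)) {g | (expMeanLogSU : LoopAverage (Node00.SU N)).δ ≤ dist1 g} ≠ 0 := by
  have hcont : Continuous (dist1 : Node00.SU N → ℝ) :=
    UnitaryModel.continuous_opDist1.comp (Literature.MathematicalPhysics.QuantumLattice.continuous_fundamentalRep (Fin N))
  have hopen : IsOpen {g : Node00.SU N | (expMeanLogSU : LoopAverage (Node00.SU N)).δ < dist1 g} := isOpen_lt continuous_const hcont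
  have hδ : (expMeanLogSU : LoopAverage (Node00.SU N)).δ ≤ 1 / 3 := by
    rw [expMeanLogSU_δ]
    exact min_le_left _ _
  obtain ⟨D, hle, hge⟩ := K0BgProvisoOverRange.exists_su_conj_norm_sub_one_ge (N := N) hN (t := 2) (by norm_num) le_rfl
  have hD : dist1 D = 2 := by
    refine le_antisymm hle ?_
    have h := hge 1
    simp only [Units.val_one, inv_one, one_mul, mul_one] at h
    exact h
  have hlt : (expMeanLogSU : LoopAverage (Node00.SU N)).δ < dist1 D := by
    rw [hD]
    linarith
  haveI : (HaarData.haar : Measure (Node00.SU N)).IsHaarMeasure := Measure.isHaarMeasure_haarMeasure _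
  intro h0
  have hpos := hopen.measure_pos (HaarData.haar : Measure (Node00.SU N)) ⟨D, hlt⟩
  exact hpos.ne' (measure_mono_null (fun g (hg : _ < dist1 g) => hg.le) h0)

/-- **★★★ REVERSE HAAR-A.C. OF THE RESTRICTED AVERAGING OF RECORD, HYPOTHESIS-FREE for `N ≥ 2`** (saturated region, `bondsIn j Y ⊆ sV`, `sV' ⊆ bondsIn (j+1) Y`,
standing range). [cite: Balaban1988Convergent, (2.21) p.258; Balaban1987RG1, (0.4) p.253 (bookkeeping)] -/
theorem pi_absolutelyContinuous_map_avgRestrOfRecord_of_two_le (hN : 2 ≤ N) (K j : ℕ) [DecidableEq (PBond (F.P K) j)]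
    (hj : j + 1 ≤ (F.P K).m + (F.P K).K)
    {Y : Set (Site (F.P K) 0)} (hY : ∀ s : Site (F.P K) j, toFine j s ∈ Y ↔ toFine (j + 1) (blockOf s) ∈ Y)
    {sV : Finset (PBond (F.P K) j)} (hsV : ∀ b : PBond (F.P K) j, b ∈ bondsIn j Y → b ∈ sV)
    {sV' : Finset (PBond (F.P K) (j + 1))} (hsV' : ∀ c : PBond (F.P K) (j + 1), c ∈ sV' → c ∈ bondsIn (j + 1) Y) :
    (Measure.pi fun _ : ↥sV' => (HaarData.haar : Measure (Node00.SU N))) ≪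
      (Measure.pi fun _ : ↥sV => (HaarData.haar : Measure (Node00.SU N))).map (avgRestrOfRecord F N K j sV sV') :=
  pi_absolutelyContinuous_map_avgRestrOfRecord F N K j hj (haar_setOf_delta_le_dist1_ne_zero N hN) hY hsV hsV'

/-- **★★★ REVERSE HAAR-A.C. AT THE GENERATION DATA OF RECORD, HYPOTHESIS-FREE for `N ≥ 2`** (every history `s`, branch `S`, generation `j` in the standing range):
`Π_{sV'} Haar ≪ (Π_{sV} Haar).map (avgRestrOfRecord …)` for `sV ∕ sV'` = the V-bond ∕ image-bond sets of `genDataOfRecord … s S j` — the (R1) row of the located sentence's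
off-top support inclusion is a THEOREM. [cite: Balaban1988Convergent, (2.21) p.258 (bookkeeping)] -/
theorem pi_absolutelyContinuous_map_avgRestrOfRecord_genData_of_two_le (hN : 2 ≤ N) {V : Type} (ν : Stage7Numerics) (M : ℕ) (g : ℕ → ℝ) (K : ℕ)
    (W : TkWeights F N V K) {k : ℕ} (s : SeqOfRecord F ν M g K k) (S : ℕ → Set (Site (F.P K) 0)) (j : ℕ) {hdec : DecidableEq (PBond (F.P K) j)}
    (hj : j + 1 ≤ (F.P K).m + (F.P K).K) :
    (Measure.pi fun _ : ↥(genDataOfRecord F N V ν M g K W s S j).sV' => (HaarData.haar : Measure (Node00.SU N))) ≪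
      (Measure.pi fun _ : ↥(genDataOfRecord F N V ν M g K W s S j).sV => (HaarData.haar : Measure (Node00.SU N))).map
        (avgRestrOfRecord F N K j (genDataOfRecord F N V ν M g K W s S j).sV (genDataOfRecord F N V ν M g K W s S j).sV') :=
  pi_absolutelyContinuous_map_avgRestrOfRecord_genData F N ν M g K W s S j hj (haar_setOf_delta_le_dist1_ne_zero N hN)

end Guard

end Summit.QuantumFields.YangMills.Theorems.BalabanUVNodesN11RestrictedAveragingReverseAC

end
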